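import Mathlib

/-!
# The rank-certificate engine: `|S| ≤ |J|^n` from per-coordinate evaluation functions

Support file for item stmt-MatrixMultiplication-14308 (route `FourierTwoFamiliesModP`, decl
`PrimeTwoFamilies`, line Sketch, c4 "Paley capacity minus one").

This is the linear-algebra ("polynomial method") engine of Blokhuis (1993) / Alon (1998) with an
ARBITRARY finite-dimensional function space on each coordinate in place of the polynomials of degree
`≤ d`: a word `u ∈ S ⊆ V^n` comes with functions `f u i : V → F` (`i : Fin n`), each in the `F`-span of
`|J|` fixed functions `b j : V → F`, with `f u i (u i) ≠ 0`, and such that for every other word `v ∈ S`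
some `f u i` vanishes at `v i`.  Then the product functions `P_u(x) = ∏_i f u i (x_i)` on `V^n` have a
diagonal value matrix `(P_u(v))_{u,v ∈ S}` with non-zero diagonal, hence are linearly independent
(the "diagonal criterion", Jukna, *Extremal Combinatorics* (2011), Lemma 14.11), and they lie in the
span of the `|J|^n` product functions `x ↦ ∏_i b (e i) (x_i)` (`e : Fin n → J`); so `|S| ≤ |J|^n`.

The polynomial instance (`b j = X^j`, `j ≤ d`) is
`Literature.Combinatorics.Extremal.card_le_pow_of_eval_polynomials`, whose proof is adapted here; the
lead file applies the present version with Gauss-period (additive-character) functions on `ZMod q`.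

No definitions; Mathlib only.
-/

-- the summit path `Summits/MatrixMultiplication/MatrixMultiplication/…` forces the repeated namespace segment
set_option linter.dupNamespace false

namespace Summit.MatrixMultiplication.MatrixMultiplication.Theorems.PrimeTwoFamilies.PaleyRankBound

open Finset

/-- **The evaluation-span engine (polynomial method with an arbitrary function space).**
Let `b j : V → F` (`j : J`, `J` finite) be functions into a field, `S` a finite set of words
`Fin n → V`, and suppose every word `u ∈ S` comes with functions `f u i : V → F` (`i : Fin n`) such that
* each `f u i` is an `F`-linear combination of the `b j` (`hspan`),
* `f u i (u i) ≠ 0` for every `i` (`hdiag`), and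
* for every other word `v ∈ S` some coordinate `i` has `f u i (v i) = 0` (`hoff`).
Then `|S| ≤ |J|^n`: the functions `x ↦ ∏_i f u i (x_i)` (`u ∈ S`) are linearly independent (their value
matrix on `S` is diagonal with non-zero diagonal) and lie in the span of the `|J|^n` products
`x ↦ ∏_i b (e i) (x_i)`, `e : Fin n → J`.  (Blokhuis 1993 / Alon 1998 use `b j = X^j`, `j ≤ d`; cf.
`Literature.Combinatorics.Extremal.card_le_pow_of_eval_polynomials`.) -/
theorem card_le_pow_of_eval_span {F V J : Type*} [Field F] [DecidableEq V] [Fintype J]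
    {n : ℕ} (b : J → V → F) (S : Finset (Fin n → V)) (f : (Fin n → V) → Fin n → V → F)
    (hspan : ∀ u ∈ S, ∀ i, ∃ c : J → F, ∀ x, f u i x = ∑ j, c j * b j x)
    (hdiag : ∀ u ∈ S, ∀ i, f u i (u i) ≠ 0)
    (hoff : ∀ u ∈ S, ∀ v ∈ S, u ≠ v → ∃ i, f u i (v i) = 0) :
    S.card ≤ Fintype.card J ^ n := by
  classical
  -- adapted from `Literature/Combinatorics/Extremal/SpernerCapacityOutDegreeBound.lean`
  -- (`card_le_pow_of_eval_polynomials`): the functions `P u` and the products `M e` on `V^n`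
  let P : (Fin n → V) → (Fin n → V) → F := fun u x => ∏ i, f u i (x i)
  let M : (Fin n → J) → (Fin n → V) → F := fun e x => ∏ i, b (e i) (x i)
  let W : Submodule F ((Fin n → V) → F) := Submodule.span F (Set.range M)
  -- (1) every `P u`, `u ∈ S`, lies in the span `W` of the `|J|^n` products `M e`
  have hPW : ∀ u ∈ S, P u ∈ W := by
    intro u hu
    choose c hc using fun i => hspan u hu i
    have hexp : P u = ∑ e : Fin n → J, (∏ i, c i (e i)) • M e := by
      funext x
      rw [Finset.sum_apply]
      simp only [P, M, Pi.smul_apply, smul_eq_mul]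
      simp_rw [hc]
      rw [Fintype.prod_sum]
      refine Finset.sum_congr rfl fun e _ => ?_
      rw [Finset.prod_mul_distrib]
    rw [hexp]
    refine Submodule.sum_mem _ fun e _ => Submodule.smul_mem _ _ ?_
    exact Submodule.subset_span ⟨e, rfl⟩
  -- (2) the value matrix on `S` is diagonal with non-zero diagonal
  have hzero : ∀ u ∈ S, ∀ v ∈ S, u ≠ v → P u v = 0 := by
    intro u hu v hv hne
    obtain ⟨i, hi⟩ := hoff u hu v hv hne
    exact Finset.prod_eq_zero (Finset.mem_univ i) hi
  have hne0 : ∀ u ∈ S, P u u ≠ 0 := by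
    intro u hu
    exact Finset.prod_ne_zero_iff.mpr fun i _ => hdiag u hu i
  -- (3) linear independence of `(P u)_{u ∈ S}` inside `W`
  have hli : LinearIndependent F (fun u : S => (⟨P u, hPW u u.2⟩ : W)) := by
    apply LinearIndependent.of_comp W.subtype
    rw [linearIndependent_iff']
    intro s g hg u hu
    have h := congrFun hg (u : Fin n → V)
    rw [Finset.sum_apply] at h
    simp only [Function.comp_apply, Submodule.subtype_apply, Pi.smul_apply, smul_eq_mul,
      Pi.zero_apply] at h
    rw [Finset.sum_eq_single u] at h
    · exact (mul_eq_zero.mp h).resolve_right (hne0 _ u.2)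
    · intro v _ hvu
      have hne : (v : Fin n → V) ≠ u := fun e => hvu (Subtype.ext e)
      rw [hzero _ v.2 _ u.2 hne, mul_zero]
    · intro hu'
      exact absurd hu hu'
  -- (4) count dimensions
  haveI : Module.Finite F W := Module.Finite.span_of_finite F (Set.finite_range M)
  have h1 : Fintype.card S ≤ Module.finrank F W := hli.fintype_card_le_finrank
  have h2 : Module.finrank F W ≤ Fintype.card (Fin n → J) := finrank_range_le_card M
  rw [Fintype.card_coe] at h1
  rw [Fintype.card_fun, Fintype.card_fin] at h2
  exact h1.trans h2

end Summit.MatrixMultiplication.MatrixMultiplication.Theorems.PrimeTwoFamilies.PaleyRankBound
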